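import Summits.ValiantsHypothesis.ValiantsHypothesis.Theorems.KPlusLogSqLawWeakLiftingTowerGraftTwoSidedClusteredLowersLaw
import Summits.ValiantsHypothesis.ValiantsHypothesis.Theorems.KPlusLogSqLawWeakLiftingTowerGraftTwoSidedClusteredFourLettersDefinite

/-!
# The MIRROR four-letter `2m` law for DEFINITE-TYPE roots of any corank (pub-symmetroid LINE (B) `tower_graft`, helper lane)

Part J (`TwoSidedThree.card_posRoots_le_two_mul_four_letters_lower`) proves `Z₊ ≤ 2m` for the mirror clustered word
`X^{d₀}P₁ + X^{d₀+g}P₂ + X^{d₀+2g}J + X^{d₀+4g}C` (`P₁ ≻ 0`, `C ≻ 0`, `P₂ ⪰ 0`, `J` any symmetric) under SIMPLE CROSSINGS; here the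
corank restriction is removed (the analogue of part I for the mirror word): the family certificate
`card_posType_family_le_rank_four_letters_lower` is part I's `card_negType_family_le_rank_four_letters` read at `σ = τ⁻¹`
(same-scale pairs orthogonal for `2τ⁴C − 2P₁ − τP₂`), and `card_posRoots_le_two_mul_four_letters_lower_of_definite` assembles it
with `exists_kernel_orthogonal_family` and the inertia kit.

Honest scope: clustered support only; nothing on S4/S4b/S4d/S4f/S5, (TB), 19561 proper, 18050, VP ≠ VNP.
-/

set_option linter.dupNamespace false
set_option autoImplicit false

namespace Summit.ValiantsHypothesis.ValiantsHypothesis.Theorems.KPlusLogSqLaw.TowerGraft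

open Matrix
open scoped BigOperators

namespace TwoSidedThree

section ClusteredLowerFamily

variable {m : ℕ} {I : Type} [Fintype I] [DecidableEq I]

/-- **mirror four-letter family certificate** (`P₁ + τP₂ + τ²J + τ⁴C`, scales may repeat): EXITING-type kernel pairs number at most
`rank C`, given orthogonality of same-scale pairs for `2τ⁴C − 2P₁ − τP₂` (`horth`).  Proof: part I's family theorem at `σ = τ⁻¹`. [folklore] -/
theorem card_posType_family_le_rank_four_letters_lower (P₁ P₂ J C : Matrix (Fin m) (Fin m) ℝ) (τ : I → ℝ) (u : I → Fin m → ℝ)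
    (hP₁ : P₁.PosSemidef) (hP₂ : P₂.PosSemidef) (hJ : J.IsSymm) (hC : C.PosSemidef) (hτ : ∀ i, 0 < τ i)
    (hker : ∀ i, (P₁ + τ i • P₂ + τ i ^ 2 • J + τ i ^ 4 • C) *ᵥ u i = 0)
    (htype : ∀ i, 2 * (u i ⬝ᵥ (P₁ *ᵥ u i)) + τ i * (u i ⬝ᵥ (P₂ *ᵥ u i)) < 2 * τ i ^ 4 * (u i ⬝ᵥ (C *ᵥ u i)))
    (horth : ∀ i k, i ≠ k → τ i = τ k →
      2 * τ i ^ 4 * (u i ⬝ᵥ (C *ᵥ u k)) = 2 * (u i ⬝ᵥ (P₁ *ᵥ u k)) + τ i * (u i ⬝ᵥ (P₂ *ᵥ u k))) :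
    Fintype.card I ≤ C.rank := by
  refine card_negType_family_le_rank_four_letters C J (fun i => (τ i)⁻¹) u P₂ P₁ hC hJ hP₂ hP₁
    (fun i => inv_pos.mpr (hτ i)) ?_ ?_ ?_
  · intro i
    have hτi : τ i ≠ 0 := ne_of_gt (hτ i)
    have h := congrArg (fun w => ((τ i)⁻¹) ^ 4 • w) (hker i)
    simp only [smul_zero] at h
    rw [← h, ← Matrix.smul_mulVec]
    congr 1
    have e1 : (τ i)⁻¹ ^ 4 * τ i = (τ i)⁻¹ ^ 3 := by field_simp
    have e2 : (τ i)⁻¹ ^ 4 * τ i ^ 2 = (τ i)⁻¹ ^ 2 := by field_simp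
    have e4 : (τ i)⁻¹ ^ 4 * τ i ^ 4 = 1 := by field_simp
    rw [smul_add, smul_add, smul_add, smul_smul, smul_smul, smul_smul, e1, e2, e4, one_smul]
    abel
  · intro i
    have hτi := hτ i
    have ht := htype i
    have hpow : 0 < (τ i)⁻¹ ^ 4 := pow_pos (inv_pos.mpr hτi) _
    have h1 := mul_lt_mul_of_pos_left ht hpow
    have e0 : (τ i)⁻¹ ^ 4 * (2 * τ i ^ 4 * (u i ⬝ᵥ (C *ᵥ u i))) = 2 * (u i ⬝ᵥ (C *ᵥ u i)) := by
      field_simp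
    have e1 : (τ i)⁻¹ ^ 4 * (2 * (u i ⬝ᵥ (P₁ *ᵥ u i)) + τ i * (u i ⬝ᵥ (P₂ *ᵥ u i)))
        = (τ i)⁻¹ ^ 3 * (u i ⬝ᵥ (P₂ *ᵥ u i)) + 2 * (τ i)⁻¹ ^ 4 * (u i ⬝ᵥ (P₁ *ᵥ u i)) := by
      field_simp
      ring
    rw [e0, e1] at h1
    exact h1
  · intro i k hik hτik
    have hτi := ne_of_gt (hτ i)
    have h := horth i k hik (inv_injective hτik)
    show 2 * (u i ⬝ᵥ (C *ᵥ u k)) = (τ i)⁻¹ ^ 3 * (u i ⬝ᵥ (P₂ *ᵥ u k)) + 2 * (τ i)⁻¹ ^ 4 * (u i ⬝ᵥ (P₁ *ᵥ u k))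
    field_simp
    linear_combination h

end ClusteredLowerFamily

/-! ## The census-currency mirror law for definite-type roots of any corank -/

section FourLettersLowerDefinite

open Polynomial
open Summit.ValiantsHypothesis.ValiantsHypothesis.Theorems.LacunarySymmetroidMatrixDescartes

variable {m : ℕ}

/-- **THE MIRROR FOUR-LETTER `2m` LAW, DEFINITE TYPE (any corank)** on `(d₀, d₀+g, d₀+2g, d₀+4g)`: `P₁ ≻ 0`, `C ≻ 0`, `P₂ ⪰ 0`,
`J` ANY symmetric, `g ≥ 1`; if every positive root of `det F` is of DEFINITE type then `Z₊(mult) ≤ 2m` (part J's `hcorank` removed).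
[folklore] -/
theorem card_posRoots_le_two_mul_four_letters_lower_of_definite (P₁ P₂ J C : Matrix (Fin m) (Fin m) ℝ) (hP₁ : P₁.PosDef)
    (hP₂ : P₂.PosSemidef) (hJ : J.IsSymm) (hC : C.PosDef) (d₀ g : ℕ) (hg : 0 < g)
    (htype : ∀ t : ℝ, 0 < t →
      (∑ k : Fin 4, t ^ (![d₀, d₀ + g, d₀ + 2 * g, d₀ + 4 * g] k) • (![P₁, P₂, J, C] k)).det = 0 →
      (∀ u : Fin m → ℝ, (∑ k : Fin 4, t ^ (![d₀, d₀ + g, d₀ + 2 * g, d₀ + 4 * g] k) • (![P₁, P₂, J, C] k)) *ᵥ u = 0 →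
        u ≠ 0 → (derivative (∑ k : Fin 4, Polynomial.C (u ⬝ᵥ ((![P₁, P₂, J, C] k) *ᵥ u)) *
          (X : ℝ[X]) ^ (![d₀, d₀ + g, d₀ + 2 * g, d₀ + 4 * g] k))).eval t < 0) ∨
      (∀ u : Fin m → ℝ, (∑ k : Fin 4, t ^ (![d₀, d₀ + g, d₀ + 2 * g, d₀ + 4 * g] k) • (![P₁, P₂, J, C] k)) *ᵥ u = 0 →
        u ≠ 0 → 0 < (derivative (∑ k : Fin 4, Polynomial.C (u ⬝ᵥ ((![P₁, P₂, J, C] k) *ᵥ u)) *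
          (X : ℝ[X]) ^ (![d₀, d₀ + g, d₀ + 2 * g, d₀ + 4 * g] k))).eval t)) :
    Multiset.card ((Matrix.det (∑ k : Fin 4, ((X : ℝ[X]) ^ (![d₀, d₀ + g, d₀ + 2 * g, d₀ + 4 * g] k)) •
      (![P₁, P₂, J, C] k).map Polynomial.C)).roots.filter (fun t => 0 < t)) ≤ 2 * m := by
  classical
  set dv : Fin 4 → ℕ := ![d₀, d₀ + g, d₀ + 2 * g, d₀ + 4 * g] with hdv
  set Sv : Fin 4 → Matrix (Fin m) (Fin m) ℝ := ![P₁, P₂, J, C] with hSv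
  have hP₁s : P₁.IsSymm := by
    have h1 := hP₁.1; unfold Matrix.IsHermitian at h1
    rwa [Matrix.conjTranspose_eq_transpose_of_trivial] at h1
  have hP₂s : P₂.IsSymm := by
    have h1 := hP₂.1; unfold Matrix.IsHermitian at h1
    rwa [Matrix.conjTranspose_eq_transpose_of_trivial] at h1
  have hCs : C.IsSymm := by
    have h1 := hC.1; unfold Matrix.IsHermitian at h1
    rwa [Matrix.conjTranspose_eq_transpose_of_trivial] at h1
  have hS : ∀ k, (Sv k).IsSymm := by
    intro k; fin_cases k
    · exact hP₁s
    · exact hP₂s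
    · exact hJ
    · exact hCs
  have hmin : ∀ l : Fin 4, l ≠ 0 → dv 0 < dv l := by
    intro l hl; fin_cases l
    · exact absurd rfl hl
    · show d₀ < d₀ + g; omega
    · show d₀ < d₀ + 2 * g; omega
    · show d₀ < d₀ + 4 * g; omega
  have hmax : ∀ l : Fin 4, l ≠ 3 → dv l < dv 3 := by
    intro l hl; fin_cases l
    · show d₀ < d₀ + 4 * g; omega
    · show d₀ + g < d₀ + 4 * g; omega
    · show d₀ + 2 * g < d₀ + 4 * g; omega
    · exact absurd rfl hl
  have h0 : (Sv 0).det ≠ 0 := by show P₁.det ≠ 0; exact hP₁.det_pos.ne'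
  have h3 : (Sv 3).det ≠ 0 := by show C.det ≠ 0; exact hC.det_pos.ne'
  let negType : ℝ → Prop := fun t => ∀ u : Fin m → ℝ, (∑ k, t ^ dv k • Sv k) *ᵥ u = 0 → u ≠ 0 →
    (derivative (∑ k, Polynomial.C (u ⬝ᵥ (Sv k *ᵥ u)) * (X : ℝ[X]) ^ dv k)).eval t < 0
  obtain ⟨hidx, -, hsum⟩ := Inertia.global_index_formula dv Sv hS 0 3 hmin hmax h0 h3 htype negType
    (fun t _ _ => Iff.rfl)
  have hν0 : Fintype.card {j // (Inertia.isHermitian_of_isSymm (hS 0)).eigenvalues j < 0} = 0 := by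
    rw [Fintype.card_eq_zero_iff]
    refine ⟨fun ⟨j, hj⟩ => ?_⟩
    have hp : 0 < (Inertia.isHermitian_of_isSymm (hS 0)).eigenvalues j := hP₁.eigenvalues_pos j
    linarith
  have hν3 : Fintype.card {j // (Inertia.isHermitian_of_isSymm (hS 3)).eigenvalues j < 0} = 0 := by
    rw [Fintype.card_eq_zero_iff]
    refine ⟨fun ⟨j, hj⟩ => ?_⟩
    have hp : 0 < (Inertia.isHermitian_of_isSymm (hS 3)).eigenvalues j := hC.eigenvalues_pos j
    linarith
  rw [hν0, hν3, zero_add, zero_add] at hidx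
  set P := Matrix.det (∑ k, ((X : ℝ[X]) ^ dv k) • (Sv k).map Polynomial.C) with hP
  set q : ℝ → Prop := fun t => 0 < t ∧ ¬ negType t with hq
  -- `N⁺ = ∑ corank` over the distinct exiting roots
  have hdef : ∀ t ∈ P.roots.toFinset.filter q, ∀ v : Fin m → ℝ, (∑ k, t ^ dv k • Sv k) *ᵥ v = 0 → v ≠ 0 →
      (derivative (∑ k, Polynomial.C (v ⬝ᵥ (Sv k *ᵥ v)) * (X : ℝ[X]) ^ dv k)).eval t ≠ 0 := by
    intro t ht v hv hv0
    obtain ⟨hmem, htq⟩ := Finset.mem_filter.mp ht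
    obtain ⟨-, hroot⟩ := (Polynomial.mem_roots').mp (Multiset.mem_toFinset.mp hmem)
    have hdet : (∑ k, t ^ dv k • Sv k).det = 0 := by
      have h1 : P.eval t = 0 := hroot
      rwa [hP, DefiniteMoments.eval_det_pencil] at h1
    rcases htype t htq.1 hdet with h | h
    · exact ne_of_lt (h v hv hv0)
    · exact ne_of_gt (h v hv hv0)
  have hN : ∑ t ∈ P.roots.toFinset.filter q, (Fintype.card (Fin m) - (∑ k, t ^ dv k • Sv k).rank)
      = Multiset.card (P.roots.filter q) := Inertia.sum_corank_eq_card_roots_filter dv Sv hS q hdef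
  set T := P.roots.toFinset.filter q with hTdef
  have hTpos : ∀ t ∈ T, 0 < t := fun t ht => (Finset.mem_filter.mp ht).2.1
  have hTtype : ∀ t ∈ T, ∀ u : Fin m → ℝ, (∑ k, t ^ dv k • Sv k) *ᵥ u = 0 → u ≠ 0 →
      0 < (derivative (∑ k, Polynomial.C (u ⬝ᵥ (Sv k *ᵥ u)) * (X : ℝ[X]) ^ dv k)).eval t := by
    intro t ht u hu hu0
    obtain ⟨hmem, htq⟩ := Finset.mem_filter.mp ht
    obtain ⟨-, hroot⟩ := (Polynomial.mem_roots').mp (Multiset.mem_toFinset.mp hmem)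
    have hdet : (∑ k, t ^ dv k • Sv k).det = 0 := by
      have h1 : P.eval t = 0 := hroot
      rwa [hP, DefiniteMoments.eval_det_pencil] at h1
    rcases htype t htq.1 hdet with hneg | hposT
    · exact absurd hneg htq.2
    · exact hposT u hu hu0
  -- an orthogonal kernel family at each root of `T`, for the form `Φ_t = 2τ⁴C − 2P₁ − τP₂`, `τ = t^g`
  have hfam : ∀ t : T, ∃ v : Fin (m - (∑ k, (t : ℝ) ^ dv k • Sv k).rank) → (Fin m → ℝ),
      (∀ j, (∑ k, (t : ℝ) ^ dv k • Sv k) *ᵥ v j = 0) ∧ (∀ j, v j ≠ 0) ∧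
      ∀ j j', j ≠ j' → v j ⬝ᵥ (((2 * ((t : ℝ) ^ g) ^ 4) • C - (2 : ℝ) • P₁ - ((t : ℝ) ^ g) • P₂) *ᵥ v j') = 0 := by
    intro t
    refine exists_kernel_orthogonal_family _ _ ?_
    unfold Matrix.IsSymm
    rw [Matrix.transpose_sub, Matrix.transpose_sub, Matrix.transpose_smul, Matrix.transpose_smul, Matrix.transpose_smul,
      hP₁s, hP₂s, hCs]
  choose v hv0 hvne hvorth using hfam
  let Idx := Σ t : T, Fin (m - (∑ k, (t : ℝ) ^ dv k • Sv k).rank)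
  have hcard : Fintype.card Idx = ∑ t ∈ T, (Fintype.card (Fin m) - (∑ k, t ^ dv k • Sv k).rank) := by
    rw [Fintype.card_sigma]
    simp only [Fintype.card_fin]
    exact (Finset.sum_coe_sort T (fun t => m - (∑ k, t ^ dv k • Sv k).rank))
  have hbound : Fintype.card Idx ≤ C.rank := by
    refine card_posType_family_le_rank_four_letters_lower (I := Idx) P₁ P₂ J C (fun p => ((p.1 : ℝ)) ^ g) (fun p => v p.1 p.2)
      hP₁.posSemidef hP₂ hJ hC.posSemidef (fun p => pow_pos (hTpos p.1 p.1.2) g)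
      (fun p => reduced_kernel4_lower P₁ P₂ J C d₀ g (hTpos p.1 p.1.2) _ (hv0 p.1 p.2)) ?_ ?_
    · intro p
      have ht := hTpos p.1 p.1.2
      have hposT := hTtype p.1 p.1.2 (v p.1 p.2) (hv0 p.1 p.2) (hvne p.1 p.2)
      have heq := rayleigh_deriv_eq4_lower P₁ P₂ J C d₀ g ht _ (hv0 p.1 p.2)
      have h1 : 0 < (p.1 : ℝ) * (derivative (∑ k : Fin 4, Polynomial.C (v p.1 p.2 ⬝ᵥ ((![P₁, P₂, J, C] k) *ᵥ v p.1 p.2)) *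
          (X : ℝ[X]) ^ (![d₀, d₀ + g, d₀ + 2 * g, d₀ + 4 * g] k))).eval (p.1 : ℝ) := mul_pos ht hposT
      rw [heq] at h1
      have h2 : 0 < (g : ℝ) * (p.1 : ℝ) ^ d₀ := mul_pos (Nat.cast_pos.mpr hg) (pow_pos ht _)
      by_contra hcon
      push Not at hcon
      have h3 : 2 * ((p.1 : ℝ) ^ g) ^ 4 * (v p.1 p.2 ⬝ᵥ (C *ᵥ v p.1 p.2)) - 2 * (v p.1 p.2 ⬝ᵥ (P₁ *ᵥ v p.1 p.2))
          - (p.1 : ℝ) ^ g * (v p.1 p.2 ⬝ᵥ (P₂ *ᵥ v p.1 p.2)) ≤ 0 := by linarith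
      have := mul_nonpos_of_nonneg_of_nonpos h2.le h3
      linarith
    · rintro ⟨t, j⟩ ⟨t', j'⟩ hne htt'
      simp only at htt'
      have htt : t = t' := Subtype.ext
        ((pow_left_inj₀ (hTpos t.1 t.2).le (hTpos t'.1 t'.2).le (Nat.pos_iff_ne_zero.mp hg)).mp htt')
      subst htt
      have hjj : j ≠ j' := fun h => hne (by subst h; rfl)
      have h := hvorth t j j' hjj
      rw [Matrix.sub_mulVec, Matrix.sub_mulVec, Matrix.smul_mulVec, Matrix.smul_mulVec, Matrix.smul_mulVec,
        dotProduct_sub, dotProduct_sub, dotProduct_smul, dotProduct_smul, dotProduct_smul, smul_eq_mul, smul_eq_mul,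
        smul_eq_mul] at h
      linarith
  have hCm : C.rank ≤ m := (Matrix.rank_le_width C).trans le_rfl
  rw [← hsum]
  have hNle : Multiset.card (P.roots.filter q) ≤ m := by
    rw [← hN, ← hcard]
    exact hbound.trans hCm
  have hidx' : Multiset.card (P.roots.filter fun t => 0 < t ∧ negType t) = Multiset.card (P.roots.filter q) := hidx.symm
  rw [hidx']
  omega


end FourLettersLowerDefinite

end TwoSidedThree

end Summit.ValiantsHypothesis.ValiantsHypothesis.Theorems.KPlusLogSqLaw.TowerGraft
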